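import Mathlib
import Summits.ValiantsHypothesis.ValiantsHypothesis.Theorems.NewtonUnitEquationsDissociatedUniformTotalsLawGeneral
import Literature.Computability.AlgebraicComplexity.NewtonPolygonTauTransfer
import HarnessLib

/-!
# Crux `NewtonUnitEquations.DissociatedUniform` (stmt-ValiantsHypothesis-5905): totals law — DYNAMIC-PROGRAMMING VERTEX CERTIFICATES

Tool file (model (Q**), memo `Cruxes/DissociatedUniform/NOTES-t1.md` §1): a kernel-checkable way to certify LOWER bounds on the
class-hull vertex counts `classVert c s` / `totalVert c` of an explicit design `c : Fin n → G → ℝ²` with INTEGER coordinates,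
without enumerating the `|G|^(n-1)` points of a class.  A class point `p = ∑_j c_j (x*_j)` is a hull vertex as soon as some integer
weight `w = (a, b)` scores it STRICTLY above every other class point (exposed ⇒ extreme,
`KPTT.mem_extremePoints_convexHull_of_linear`); and "every word `x ≠ x*` with `∑ x = s` scores `< OPT`" follows from two small TABLES
indexed by (number of letters fixed, residue): `W k r` bounding the score of every suffix word from position `k` with residue `r`, and
`D k r` bounding every such suffix word that DEVIATES from `x*` — a max-plus dynamic programme over `G`, whose local consistency
conditions (`h0`, `hW`, `hD₁`, `hD₂`, each a closed integer inequality) are checked by `decide` and whose soundness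
(`sum_le_table`, `sum_le_dtable`) is proved here once, by induction on `n`.  `mem_extremePoints_of_cert` packages the certificate;
`wsum`/`vsum` are the recursive sums the certificates are stated with (`wsum_eq`, `vsum_eq`).
Used by the companion files `…TotalsLawTernaryData*` / `…TotalsLawTernary` to refute the constant `C = 1` of the typed general law at
`G = ℤ/3`, `n = 9`.  Nothing here is specific to that example.
[folklore: extreme points of the hull of a finite set lie in the set]
-/

set_option linter.dupNamespace false -- `ValiantsHypothesis.ValiantsHypothesis` (summit = problem) in every name

open scoped BigOperators

namespace Summit.ValiantsHypothesis.ValiantsHypothesis.Theorems.NewtonUnitEquationsDissociatedUniform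

namespace TotalsLawN

namespace Cert

/-- Recursive score `g 0 (x 0) + g 1 (x 1) + ⋯` (a `decide`-friendly form of `∑ j, g j (x j)`). -/
def vsum {α : Type*} : (n : ℕ) → (Fin n → α → ℤ) → (Fin n → α) → ℤ
  | 0, _, _ => 0
  | n + 1, g, x => g 0 (x 0) + vsum n (Fin.tail g) (Fin.tail x)

/-- `vsum` is the score. [folklore] -/
theorem vsum_eq {α : Type*} : ∀ (n : ℕ) (g : Fin n → α → ℤ) (x : Fin n → α), vsum n g x = ∑ j, g j (x j)
  | 0, g, x => by simp [vsum]
  | n + 1, g, x => by rw [vsum, Fin.sum_univ_succ, vsum_eq n]; rfl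

variable {G : Type*} [AddCommGroup G]

/-- Recursive word sum `x 0 + x 1 + ⋯` (a `decide`-friendly form of `∑ j, x j`). -/
def wsum : (n : ℕ) → (Fin n → G) → G
  | 0, _ => 0
  | n + 1, x => x 0 + wsum n (Fin.tail x)

/-- `wsum` is the sum. [folklore] -/
theorem wsum_eq : ∀ (n : ℕ) (x : Fin n → G), wsum n x = ∑ j, x j
  | 0, x => by simp [wsum]
  | n + 1, x => by rw [wsum, Fin.sum_univ_succ, wsum_eq n]; rfl

/-- **Suffix tables bound every word.**  If `0 ≤ W n 0` and `g k z + W (k+1) r ≤ W k (z + r)` for all `k < n`, `z`, `r`, then every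
word `x` scores at most `W 0 (∑ x)`. [folklore] -/
theorem sum_le_table : ∀ (n : ℕ) (g : Fin n → G → ℤ) (W : ℕ → G → ℤ), 0 ≤ W n 0 →
    (∀ k : Fin n, ∀ z r : G, g k z + W (k + 1) r ≤ W k (z + r)) →
    ∀ x : Fin n → G, ∑ j, g j (x j) ≤ W 0 (∑ j, x j)
  | 0, g, W, h0, _, x => by simpa using h0
  | n + 1, g, W, h0, hW, x => by
    rw [Fin.sum_univ_succ, Fin.sum_univ_succ]
    have ih := sum_le_table n (fun i => g i.succ) (fun k => W (k + 1)) h0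
      (fun k z r => by
        have h := hW k.succ z r
        rw [Fin.val_succ] at h
        exact h) (fun i => x i.succ)
    have h := hW 0 (x 0) (∑ i : Fin n, x i.succ)
    simp only [Fin.val_zero, zero_add] at h ih
    linarith

/-- **Deviation tables bound every word other than `x*`.**  With `W` as in `sum_le_table` and `D` satisfying
`g k z + W (k+1) r ≤ D k (z + r)` for `z ≠ x* k` and `g k (x* k) + D (k+1) r ≤ D k (x* k + r)`, every word `x ≠ x*` scores at most
`D 0 (∑ x)`. [folklore] -/
theorem sum_le_dtable : ∀ (n : ℕ) (g : Fin n → G → ℤ) (W D : ℕ → G → ℤ) (xs : Fin n → G), 0 ≤ W n 0 →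
    (∀ k : Fin n, ∀ z r : G, g k z + W (k + 1) r ≤ W k (z + r)) →
    (∀ k : Fin n, ∀ z r : G, z ≠ xs k → g k z + W (k + 1) r ≤ D k (z + r)) →
    (∀ k : Fin n, ∀ r : G, g k (xs k) + D (k + 1) r ≤ D k (xs k + r)) →
    ∀ x : Fin n → G, x ≠ xs → ∑ j, g j (x j) ≤ D 0 (∑ j, x j)
  | 0, g, W, D, xs, _, _, _, _, x, hx => absurd (Subsingleton.elim x xs) hx
  | n + 1, g, W, D, xs, h0, hW, hD₁, hD₂, x, hx => by
    rw [Fin.sum_univ_succ, Fin.sum_univ_succ]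
    have hWt : ∀ k : Fin n, ∀ z r : G, g k.succ z + W (k + 1 + 1) r ≤ W (k + 1) (z + r) := fun k z r => by
      have h := hW k.succ z r
      rw [Fin.val_succ] at h
      exact h
    by_cases h : x 0 = xs 0
    · -- the tail deviates
      have htail : (fun i : Fin n => x i.succ) ≠ fun i : Fin n => xs i.succ := by
        intro heq
        apply hx
        funext j
        refine Fin.cases h (fun i => ?_) j
        exact congrFun heq i
      have ih := sum_le_dtable n (fun i => g i.succ) (fun k => W (k + 1)) (fun k => D (k + 1)) (fun i => xs i.succ) h0 hWt
        (fun k z r hz => by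
          have h := hD₁ k.succ z r hz
          rw [Fin.val_succ] at h
          exact h)
        (fun k r => by
          have h := hD₂ k.succ r
          rw [Fin.val_succ] at h
          exact h)
        (fun i => x i.succ) htail
      have h2 := hD₂ 0 (∑ i : Fin n, x i.succ)
      simp only [Fin.val_zero, zero_add] at h2 ih
      rw [h]
      linarith
    · have ih := sum_le_table n (fun i => g i.succ) (fun k => W (k + 1)) h0 hWt (fun i => x i.succ)
      have h1 := hD₁ 0 (x 0) (∑ i : Fin n, x i.succ) h
      simp only [Fin.val_zero, zero_add] at h1 ih
      linarith

/-- The integer design `P` as curves in `ℝ²`. -/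
def curves {n : ℕ} (P : Fin n → G → ℤ × ℤ) : Fin n → G → (Fin 2 → ℝ) :=
  fun j z => ![((P j z).1 : ℝ), ((P j z).2 : ℝ)]

/-- The integer score of letter `z` at coordinate `j` for the weight `(a, b)`. -/
def score {n : ℕ} (P : Fin n → G → ℤ × ℤ) (a b : ℤ) : Fin n → G → ℤ :=
  fun j z => a * (P j z).1 + b * (P j z).2

/-- **A DP certificate exposes a class vertex.**  If the word `xs` has residue `s`, the tables `W`, `D` are consistent for the scores
of the weight `(a, b)`, and `D 0 s < score(xs)`, then the class point of `xs` is a hull vertex of the class `s` of the design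
`curves P`. [folklore] -/
theorem mem_extremePoints_of_cert [Fintype G] {n : ℕ} (P : Fin n → G → ℤ × ℤ) (a b : ℤ) (s : G) (xs : Fin n → G)
    (W D : ℕ → G → ℤ) (hs : wsum n xs = s) (h0 : 0 ≤ W n 0)
    (hW : ∀ k : Fin n, ∀ z r : G, score P a b k z + W (k + 1) r ≤ W k (z + r))
    (hD₁ : ∀ k : Fin n, ∀ z r : G, z ≠ xs k → score P a b k z + W (k + 1) r ≤ D k (z + r))
    (hD₂ : ∀ k : Fin n, ∀ r : G, score P a b k (xs k) + D (k + 1) r ≤ D k (xs k + r))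
    (hlt : D 0 s < vsum n (score P a b) xs) :
    (∑ j, curves P j (xs j)) ∈ (convexHull ℝ (classPts (curves P) s)).extremePoints ℝ := by
  rw [wsum_eq] at hs
  rw [vsum_eq] at hlt
  -- the exposing functional `y ↦ a y₀ + b y₁`
  let l : (Fin 2 → ℝ) →ₗ[ℝ] ℝ := (a : ℝ) • LinearMap.proj 0 + (b : ℝ) • LinearMap.proj 1
  have hl : ∀ x : Fin n → G, l (∑ j, curves P j (x j)) = ((∑ j, score P a b j (x j) : ℤ) : ℝ) := by
    intro x
    rw [map_sum, Int.cast_sum]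
    refine Finset.sum_congr rfl fun j _ => ?_
    simp [l, curves, score]
  refine Literature.Computability.AlgebraicComplexity.KPTT.mem_extremePoints_convexHull_of_linear ?_ l ?_
  · exact ⟨⟨xs, hs⟩, rfl⟩
  · rintro q ⟨⟨x, hx⟩, rfl⟩ hne
    have hxne : x ≠ xs := by
      rintro rfl
      exact hne rfl
    have hle := sum_le_dtable n (score P a b) W D xs h0 hW hD₁ hD₂ x hxne
    rw [hx] at hle
    show l (∑ j, curves P j (x j)) < l (∑ j, curves P j (xs j))
    rw [hl, hl]
    exact_mod_cast hle.trans_lt hlt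

/-- The extreme points of a class form a finite set. [folklore] -/
theorem finite_extremePoints_classPts [Fintype G] {n : ℕ} (c : Fin n → G → (Fin 2 → ℝ)) (s : G) :
    ((convexHull ℝ (classPts c s)).extremePoints ℝ).Finite :=
  (Set.finite_range _).subset extremePoints_convexHull_subset

/-- **Counting certified vertices.**  A finite set of points each of which is a hull vertex of the class `s` bounds `classVert`
from below. [folklore] -/
theorem card_le_classVert [Fintype G] {n : ℕ} (c : Fin n → G → (Fin 2 → ℝ)) (s : G) (V : Finset (Fin 2 → ℝ))
    (hV : ∀ p ∈ V, p ∈ (convexHull ℝ (classPts c s)).extremePoints ℝ) : V.card ≤ classVert c s := by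
  unfold classVert
  rw [← Set.ncard_coe_finset]
  exact Set.ncard_le_ncard (fun p hp => hV p (Finset.mem_coe.1 hp)) (finite_extremePoints_classPts c s)

/-! ### `decide`-friendly table and word encodings -/

/-- Select the `r`-th entry of a triple (tables over `ℤ/3`). -/
def sel (t : ℤ × ℤ × ℤ) (r : ZMod 3) : ℤ :=
  if r = 0 then t.1 else if r = 1 then t.2.1 else t.2.2

/-- A table `ℕ → ℤ/3 → ℤ` from a list of triples (rows beyond the list are `0`). -/
def tab (L : List (ℤ × ℤ × ℤ)) (k : ℕ) (r : ZMod 3) : ℤ :=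
  sel (L.getD k (0, 0, 0)) r

/-- A word `Fin n → ℤ/3` from a list of naturals. -/
def wd {n : ℕ} (L : List ℕ) (j : Fin n) : ZMod 3 :=
  ((L.getD j 0 : ℕ) : ZMod 3)

/-- A ternary design `Fin n → ℤ/3 → ℤ × ℤ` from a list of coordinate triples of integer points. -/
def design {n : ℕ} (L : List ((ℤ × ℤ) × (ℤ × ℤ) × (ℤ × ℤ))) (j : Fin n) (z : ZMod 3) : ℤ × ℤ :=
  let t := L.getD j ((0, 0), (0, 0), (0, 0))
  if z = 0 then t.1 else if z = 1 then t.2.1 else t.2.2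

/-! ### Certificate records over `ℤ/3` -/

/-- A certificate record: (word `x*` as naturals, weight `a`, weight `b`, suffix table `W`, deviation table `D`). -/
abbrev Rec : Type := List ℕ × ℤ × ℤ × List (ℤ × ℤ × ℤ) × List (ℤ × ℤ × ℤ)

/-- The six `decide`-able conditions of a DP certificate for the class `s` of the ternary integer design `P` (reducible, so
that `decide` finds the conjunction's decision procedure). -/
abbrev CertOK {n : ℕ} (P : Fin n → ZMod 3 → ℤ × ℤ) (s : ZMod 3) (rc : Rec) : Prop :=
  wsum n (wd rc.1 : Fin n → ZMod 3) = s ∧ 0 ≤ tab rc.2.2.2.1 n 0 ∧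
    (∀ k : Fin n, ∀ z r : ZMod 3, score P rc.2.1 rc.2.2.1 k z + tab rc.2.2.2.1 (k + 1) r ≤ tab rc.2.2.2.1 k (z + r)) ∧
    (∀ k : Fin n, ∀ z r : ZMod 3, z ≠ wd rc.1 k →
      score P rc.2.1 rc.2.2.1 k z + tab rc.2.2.2.1 (k + 1) r ≤ tab rc.2.2.2.2 k (z + r)) ∧
    (∀ k : Fin n, ∀ r : ZMod 3,
      score P rc.2.1 rc.2.2.1 k (wd rc.1 k) + tab rc.2.2.2.2 (k + 1) r ≤ tab rc.2.2.2.2 k (wd rc.1 k + r)) ∧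
    tab rc.2.2.2.2 0 s < vsum n (score P rc.2.1 rc.2.2.1) (wd rc.1)

/-- The integer class point of the word `xs`. -/
def ipt {n : ℕ} (P : Fin n → ZMod 3 → ℤ × ℤ) (xs : Fin n → ZMod 3) : ℤ × ℤ :=
  (vsum n (fun j z => (P j z).1) xs, vsum n (fun j z => (P j z).2) xs)

/-- An integer point as a point of `ℝ²`. -/
def castPt (p : ℤ × ℤ) : Fin 2 → ℝ := ![(p.1 : ℝ), (p.2 : ℝ)]

/-- `castPt` is injective. [folklore] -/
theorem castPt_injective : Function.Injective castPt := by
  intro p q h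
  have h0 := congrFun h 0
  have h1 := congrFun h 1
  simp only [castPt, Matrix.cons_val_zero, Matrix.cons_val_one, Int.cast_inj] at h0 h1
  exact Prod.ext h0 h1

/-- The integer class point, cast to `ℝ²`, is the class point of the design `curves P`. [folklore] -/
theorem castPt_ipt {n : ℕ} (P : Fin n → ZMod 3 → ℤ × ℤ) (xs : Fin n → ZMod 3) :
    castPt (ipt P xs) = ∑ j, curves P j (xs j) := by
  ext i
  rw [Finset.sum_apply]
  fin_cases i
  · simp [castPt, ipt, vsum_eq, curves]
  · simp [castPt, ipt, vsum_eq, curves]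

/-- **A checked record certifies a hull vertex.** [folklore] -/
theorem certOK_sound {n : ℕ} {P : Fin n → ZMod 3 → ℤ × ℤ} {s : ZMod 3} {rc : Rec} (h : CertOK P s rc) :
    castPt (ipt P (wd rc.1)) ∈ (convexHull ℝ (classPts (curves P) s)).extremePoints ℝ := by
  obtain ⟨hs, h0, hW, hD₁, hD₂, hlt⟩ := h
  rw [castPt_ipt]
  exact mem_extremePoints_of_cert P rc.2.1 rc.2.2.1 s (wd rc.1) (tab rc.2.2.2.1) (tab rc.2.2.2.2) hs h0 hW hD₁ hD₂ hlt

/-- **Counting.**  Checked records with pairwise distinct class points bound `V_s` from below by their number. [folklore] -/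
theorem length_le_classVert {n : ℕ} (P : Fin n → ZMod 3 → ℤ × ℤ) (s : ZMod 3) (recs : List Rec)
    (hok : ∀ rc ∈ recs, CertOK P s rc) (hnd : (recs.map fun rc => ipt P (wd rc.1)).Nodup) :
    recs.length ≤ classVert (curves P) s := by
  classical
  set V := ((recs.map fun rc => ipt P (wd rc.1)).toFinset).image castPt with hV
  have hcard : V.card = recs.length := by
    rw [hV, Finset.card_image_of_injective _ castPt_injective, List.toFinset_card_of_nodup hnd, List.length_map]
  rw [← hcard]
  refine card_le_classVert (curves P) s V fun p hp => ?_
  obtain ⟨q, hq, rfl⟩ := Finset.mem_image.1 hp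
  obtain ⟨rc, hrc, rfl⟩ := List.mem_map.1 (List.mem_toFinset.1 hq)
  exact certOK_sound (hok rc hrc)

end Cert

end TotalsLawN

end Summit.ValiantsHypothesis.ValiantsHypothesis.Theorems.NewtonUnitEquationsDissociatedUniform
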